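import Mathlib.NumberTheory.Padics.Hensel
import HarnessLib

/-!
# Cell abc-stewartyu, WP-A3 (iii): `p`-adic square roots of principal units (`p` odd)

`Summits/ABC/StewartYu/PadicPrincipalUnitSqrt.lean` — cell `abc-stewartyu` (HOME
`run/shared/lean/pub/abc-stewartyu/`, seat p3; theorems only, no definition, no named fact).

The `p`-adic roots `sⱼ` consumed by `PadicMultiquadratic.lean` / `PadicMultiquadraticLiouville.lean`
(and by the `p`-adic Cijsouw–Waldschmidt Steps of `HOME/p2/PADIC-CORE.md` §3, "principal `p`-adic
root `psqrt α ∈ ℤ_p`") EXIST for the generators delivered by WP-M: for an odd prime `p` and a rational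
`α` with `ord_p(α − 1) ≥ 1` there is `s ∈ ℚ_p` with `s · s = α`, `‖s‖_p ≤ 1` and `‖s − 1‖_p < 1`
(`exists_padic_sqrt_of_principal`; Hensel's lemma for `X² − α` at `1`, Mathlib `hensels_lemma`,
`‖F(1)‖ = ‖α − 1‖ < 1 = ‖F'(1)‖² = ‖2‖²`). This answers the planner's Q2 (HOME/plan/DAG.md §8):
the evaluation `evL` of the multiquadratic algebra lands in `ℚ_p` itself, no extension of `ℚ_p` is
needed. Everything is [folklore].
-/

noncomputable section

open Polynomial

namespace Summit.ABC.StewartYu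

variable {p : ℕ} [Fact p.Prime]

/-- **`p`-adic square roots of principal units.** For an odd prime `p` and `α ∈ ℚ` with
`ord_p(α − 1) ≥ 1` there is `s ∈ ℚ_p` with `s · s = α`, `‖s‖_p ≤ 1`, `‖s − 1‖_p < 1`
(Hensel's lemma for `X² − α` at the approximate root `1`). [folklore] -/
theorem exists_padic_sqrt_of_principal (hp2 : p ≠ 2) {α : ℚ}
    (h1 : 1 ≤ padicValRat p (α - 1)) :
    ∃ s : ℚ_[p], s * s = (α : ℚ_[p]) ∧ ‖s‖ ≤ 1 ∧ ‖s - 1‖ < 1 := by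
  have hα1 : α - 1 ≠ 0 := by
    intro h
    rw [h, padicValRat.zero] at h1
    exact absurd h1 (by norm_num)
  -- a non-zero rational of positive valuation lies in the open unit disc (the tree has this as
  -- `Literature.NumberTheory.PAdicPolylogarithms.norm_ratCast_lt_one_of_one_le_padicValRat`;
  -- re-derived in three lines to keep the polylogarithm files out of the import closure)
  have hsmall : ‖((α - 1 : ℚ) : ℚ_[p])‖ < 1 := by
    rw [Padic.eq_padicNorm, padicNorm.eq_zpow_of_nonzero hα1]
    have hp : (1 : ℚ) < p := by exact_mod_cast (Fact.out : p.Prime).one_lt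
    have h : ((p : ℚ) ^ (-padicValRat p (α - 1))) < 1 := zpow_lt_one_of_neg₀ hp (by linarith)
    exact_mod_cast h
  -- `‖2‖ = 1` in `ℤ_p` (`p` odd)
  have htwo : ‖(2 : ℤ_[p])‖ = 1 := by
    have h : ‖((2 : ℕ) : ℚ_[p])‖ = 1 := by
      rw [Padic.norm_natCast_eq_one_iff]
      exact (Nat.coprime_primes (Fact.out : p.Prime) Nat.prime_two).mpr hp2
    rw [PadicInt.norm_def]
    push_cast at h ⊢
    exact h
  have hsmall' : ‖(α : ℚ_[p]) - 1‖ < 1 := by push_cast at hsmall; exact hsmall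
  -- `α` is a `p`-adic integer
  have ha : ‖(α : ℚ_[p])‖ ≤ 1 := by
    have : (α : ℚ_[p]) = ((α : ℚ_[p]) - 1) + 1 := by ring
    rw [this]
    refine (Padic.nonarchimedean _ _).trans (max_le hsmall'.le ?_)
    simp
  set A : ℤ_[p] := ⟨(α : ℚ_[p]), ha⟩ with hA
  -- Hensel for `F = X² − A` at `1`
  set F : ℤ_[p][X] := X ^ 2 - C A with hF
  have hFeval : ∀ x : ℤ_[p], F.aeval x = x ^ 2 - A := fun x => by
    simp [hF, aeval_def, eval₂_sub, eval₂_pow, eval₂_X, eval₂_C]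
  have hF'eval : ∀ x : ℤ_[p], F.derivative.aeval x = 2 * x := fun x => by
    simp [hF, aeval_def, derivative_sub, derivative_pow, derivative_X, derivative_C,
      eval₂_mul, eval₂_X]
  have h2 : ‖F.derivative.aeval (1 : ℤ_[p])‖ = 1 := by
    rw [hF'eval, mul_one]; exact htwo
  have hF1 : ‖F.aeval (1 : ℤ_[p])‖ < 1 := by
    rw [hFeval, one_pow, PadicInt.norm_def]
    push_cast
    rw [show (1 : ℚ_[p]) - (A : ℚ_[p]) = -((α : ℚ_[p]) - 1) by rw [hA]; push_cast; ring, norm_neg]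
    exact hsmall'
  have hnorm : ‖F.aeval (1 : ℤ_[p])‖ < ‖F.derivative.aeval (1 : ℤ_[p])‖ ^ 2 := by
    rw [h2, one_pow]; exact hF1
  obtain ⟨z, hz, hz1, -, -⟩ := hensels_lemma hnorm
  refine ⟨(z : ℚ_[p]), ?_, z.2, ?_⟩
  · have hz' : z ^ 2 = A := sub_eq_zero.mp (by rw [← hFeval]; exact hz)
    have := congrArg (fun w : ℤ_[p] => (w : ℚ_[p])) hz'
    simp only [hA] at this
    push_cast at this
    rw [← sq]; exact this
  · rw [h2] at hz1
    have : ‖z - 1‖ = ‖(z : ℚ_[p]) - 1‖ := by rw [PadicInt.norm_def]; push_cast; rfl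
    rw [← this]; exact hz1

end Summit.ABC.StewartYu

end
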